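import Summits.PneNP.PneNP.Theorems.ReslinSizeFromWidthWidthFromVertexExpansion
import Summits.PneNP.PneNP.Theorems.ReslinSizeFromWidthRandomThreeCnfExpandsAndUnsat

/-!
# PneNP / ReslinSizeFromWidth — corollary: random 3-CNFs need linear Res(⊕) rank whp

Route `PneNP/ReslinSizeFromWidth` (supports the crux stmt-PneNP-18932 `ResLinSizeFromWidth`, whose
hypothesis is exactly a linear rank lower bound for every refutation). Combining the two landed
support items — `WidthFromVertexExpansion` (stmt-PneNP-18934, cover expansion forces rank,
`widthFromVertexExpansion_proof`) and `RandomThreeCnfExpandsAndUnsat` (stmt-PneNP-18935,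
`randomThreeCnfExpandsAndUnsat_proof`) — gives the quotable form of the rung:

* `randomThreeCnf_resLinRank_linear` — for every integer density `c ≥ 6` there is `δ > 0` such
  that, with probability `→ 1` over `φ ∼ F₃(n, cn)`, `φ` is unsatisfiable and EVERY dag-like
  Res(⊕) refutation `π` of `φ` (semantic weakening) has a line of rank `> δ n`
  (`δ n < resLinWidth π`; `δ = 3ε/8` for the expansion rate `ε` of stmt-PneNP-18935, `γ = 3/4`).

Known before only indirectly (polynomial-calculus degree for random 3-CNFs, Ben-Sasson–Impagliazzo
1999 / Alekhnovich–Razborov 2003, converted to Res(⊕) width as in Garlík–Kołodziejczyk 2018;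
Efremenko–Garlík–Itsykson 2024, p.5); here direct and kernel-checked. No SIZE lower bound for
dag-like Res(⊕) is claimed (that is the open crux stmt-PneNP-18932).

References: V. Chvátal, E. Szemerédi, J. ACM 35 (1988) [ChvatalSzemeredi1988]; S. Jukna, *Boolean
Function Complexity* (2012), Thm 18.19 [Jukna2012]; K. Efremenko, M. Garlík, D. Itsykson, STOC
2024, §1.1.1, Thm 5.5 [EfremenkoGarlikItsykson2024].
-/

namespace Summit.PneNP.PneNP.Theorems

-- `Summit.PneNP.PneNP` repeats a path component by design (summit = sub-problem); silence the linter.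
set_option linter.dupNamespace false

open Filter Literature.Computability.Complexity Literature.Computability.MetaComplexity
open scoped Topology

/-- **Random 3-CNFs need linear Res(⊕) rank whp.** For every integer density `c ≥ 6` there is
`δ > 0` with `Pr_{φ ∼ F₃(n, cn)}[φ unsatisfiable ∧ every Res(⊕) refutation π of φ has
δ·n < resLinWidth π] → 1`. From `randomThreeCnfExpandsAndUnsat_proof` (whp unsatisfiable and
`(εn, 7/4)`-cover expanding) and `widthFromVertexExpansion_proof` (`γ = 3/4`, `r = εn ≥ 2`
eventually), by monotonicity of the measure and a squeeze; `δ = 3ε/8`.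
[ChvatalSzemeredi1988; Jukna2012, Thm 18.19; EfremenkoGarlikItsykson2024, Thm 5.5] -/
theorem randomThreeCnf_resLinRank_linear (c : ℕ) (hc : 6 ≤ c) :
    ∃ δ : ℝ, 0 < δ ∧ Tendsto (fun n : ℕ => (randomKCNF 3 n (c * n)).toOuterMeasure
      {φ | ¬ CNF.Satisfiable φ ∧ ∀ π : List ResLinLine, IsResLinRefutation φ π →
        δ * n < (resLinWidth π : ℝ)}) atTop (𝓝 1) := by
  obtain ⟨ε, hε, hlim⟩ := randomThreeCnfExpandsAndUnsat_proof c hc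
  have hW := widthFromVertexExpansion_proof
  unfold Summit.PneNP.PneNP.Theses.ReslinSizeFromWidth.WidthFromVertexExpansion at hW
  refine ⟨3 * ε / 8, by positivity, ?_⟩
  -- eventually (once `ε n ≥ 2`) the expansion event lies inside the rank event
  have hev : ∀ᶠ n : ℕ in atTop,
      (randomKCNF 3 n (c * n)).toOuterMeasure
          {φ | ¬ CNF.Satisfiable φ ∧ IsCoverExpander (cnfScopes φ) (ε * n) (7 / 4)} ≤
        (randomKCNF 3 n (c * n)).toOuterMeasure
          {φ | ¬ CNF.Satisfiable φ ∧ ∀ π : List ResLinLine, IsResLinRefutation φ π →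
            3 * ε / 8 * n < (resLinWidth π : ℝ)} := by
    refine eventually_atTop.2 ⟨⌈2 / ε⌉₊, fun n hn => ?_⟩
    have hn2 : 2 ≤ ε * n := by
      have h1 : (⌈2 / ε⌉₊ : ℝ) ≤ n := by exact_mod_cast hn
      have h2 : 2 / ε ≤ n := (Nat.le_ceil _).trans h1
      rw [div_le_iff₀ hε] at h2
      linarith
    refine PMF.toOuterMeasure_mono _ ?_
    rintro φ ⟨⟨hns, hexp⟩, -⟩
    refine ⟨hns, fun π hπ => ?_⟩
    have hexp' : IsCoverExpander (cnfScopes φ) (ε * n) (1 + 3 / 4) := by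
      rw [show (1 : ℝ) + 3 / 4 = 7 / 4 by norm_num]; exact hexp
    have h := hW (3 / 4) (ε * n) φ (by norm_num) hn2 hexp' π hπ
    linarith
  refine tendsto_of_tendsto_of_tendsto_of_le_of_le' hlim tendsto_const_nhds hev
    (Eventually.of_forall fun n => ?_)
  exact (MeasureTheory.measure_mono (Set.subset_univ _)).trans_eq
    ((PMF.toOuterMeasure_apply_eq_one_iff _ _).2 (Set.subset_univ _))

end Summit.PneNP.PneNP.Theorems
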